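import Summits.Ventures.LatticeQCDFlow.Exactness.Phi4HMCTailRejection
import HarnessLib

/-!
# One-step HMC for lattice φ⁴ has NO SPECTRAL GAP at fixed step size: `sup_g ρ_g(1) = 1`

HONEST FRAMING: exact (Metropolis-corrected) sampling algorithms for lattice gauge theory;
figures of merit are autocorrelation/cost numbers at stated couplings and volumes; no
continuum-physics claim.  (SCALAR calibration rung S0-A: not a gauge result.)

Venture `LatticeQCDFlow` (cell pub-lqcd), topic `Exactness`; FANOUT row 2 (`s0-phi4`, HMC arm).
NEW WORK of the cell, composing `Exactness/Phi4HMCTailRejection.lean` (from the far box `A_t` the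
one-step update is accepted with probability `≤ ε`) with the operator calculus of
`Exactness/Phi4HMCCarreDuChamp.lean` (`hmcOpOf` is a reversible Markov operator on bounded
observables).  Nothing is cited as a fact.  Printed counterparts NAMED ONLY: Roberts–Tweedie 1996
(a Metropolis chain whose rejection probability is not essentially bounded away from `1` is not
geometrically ergodic) and Livingstone–Betancourt–Byrne–Girolami, Bernoulli 25 (2019), Thm 5.13
(corpus `paper:arxiv-1601.08057` p. 13: HMC with fixed integration time `T = Lε` is not geometrically
ergodic when `‖∇U(x)‖/‖x‖ → ∞` under two isotropic growth conditions on `∇U`, `U`).  Their second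
condition (`‖∇U(y)‖ ≥ 3‖∇U(x)‖` whenever `‖y‖ ≥ 2‖x‖ ≥ C`, Euclidean norms) FAILS for the lattice φ⁴
potential in `V ≥ 3` dimensions (take `x` far out along one coordinate and `y` spread evenly:
`Σ y⁶ = 64‖x‖⁶/V²`), so the lattice statement below — coordinatewise box, one leapfrog step, explicit
constants, every `J` — is the cell's and not an instance of the printed theorem.

## What is proved (`Λ = Fin (n+1)`, `λ > 0`, any real `J`, step size `δ > 0`;
`K = hmcOpPhi4 J λ δ 1` = refresh, ONE qpq leapfrog step, flip, Metropolis test; `w = e^{−S}`;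
`χ_t` the indicator of the box `A_t = {t ≤ φ_x ≤ 2t ∀x}`, `a_t = ⟨χ_t⟩ = π(A_t)`, `g_t = χ_t − a_t`)

* **`hmc_dirichlet_indicator_le`** — for EVERY HMC-type update `K_Ψ` (measurable Lebesgue-preserving
  involution `Ψ`) and every `0/1`-valued bounded measurable `χ` whose states are left with
  probability at most `ε` (`Z_p⁻¹∫ a(φ,p) e^{−½Σp²} dp ≤ ε` wherever `χ = 1`), the Dirichlet form of
  `g = χ − c` obeys `∫ g² w − ∫ g (K g) w ≤ ε ∫ χ w` (operator algebra: `= ∫ χ · K[1 − χ] · w`);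
* `integral_indicator_var` — `∫ (χ − ⟨χ⟩)² e^{−S} = (1 − ⟨χ⟩) ∫ χ e^{−S}` for a `0/1`-valued `χ`;
* **`hmcPhi4_oneStep_no_spectral_gap`** — for every `ε > 0` there is `t ≥ 1` with
  `⟨g_t²⟩ > 0` and `ρ_{g_t}(1) = ∫ g_t (K g_t) e^{−S} / ∫ g_t² e^{−S} ≥ 1 − ε`:
  the exact one-step HMC has NO `L²(e^{−S})` SPECTRAL GAP, at every fixed `δ > 0`, `λ > 0`, `J`;
* `hmcPhi4_oneStep_tauInt_unbounded` — consequently, for every `τ₀` there is a bounded observable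
  whose integrated autocorrelation time per update is `≥ τ₀` whenever its autocorrelation series is
  summable (Madras–Sokal floor `(1 + ρ(1))/(2(1 − ρ(1)))` of `ReversibleOperatorL2`).

Reading (no numerics implied): the absence of a gap is carried by tail boxes of astronomically small
Gibbs mass (`π(A_t) ≤ ⟨φ₀²⟩/t²` and in truth `≈ e^{−λVt⁴}`), so it says nothing about `τ_int(M)` at
simulated parameters; what it does say is that no UNIFORM-in-observable autocorrelation bound and no
geometric `L²` convergence rate exist for the fixed-step one-step arm — the certified reason adaptive
or randomised step sizes (or a Gaussian-tailed reference) are needed for uniform guarantees.  NOT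
CLAIMED: `N ≥ 2` leapfrog steps per trajectory; the local and flow arms (the local arm's proposal
does not degrade in the tails; the flow arm is uniformly ergodic iff its weights are bounded —
`FlowSamplerSpectralGap`); any statement at `λ = 0` (there the leapfrog is stable for `δ²Ω² < 4`).
-/

namespace Summit.Ventures.LatticeQCDFlow.Exactness

open Real MeasureTheory Filter Finset
open Summit.Ventures.LatticeQCDFlow.Scoring

section NoGap

variable {n : ℕ}

/-! ## §1 The Dirichlet form of an indicator whose states are rarely left -/

/-- From a configuration with `χ = 1`, the observable `1 − χ` is moved to at most the acceptance
probability: `K_Ψ[1 − χ](φ) ≤ Z_p⁻¹ ∫ a(φ,p) e^{−½Σp²} dp`. -/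
theorem hmcOpOf_one_sub_le_accept (J : Fin (n + 1) → Fin (n + 1) → ℝ) (lam δ : ℝ) (N : ℕ)
    {χ : (Fin (n + 1) → ℝ) → ℝ} (h01 : ∀ φ, χ φ = 0 ∨ χ φ = 1) {φ : Fin (n + 1) → ℝ}
    (hφ : χ φ = 1) :
    hmcOpOf J lam (hmcProposal J lam δ N) (fun ψ => 1 - χ ψ) φ
      ≤ (∫ p, involAccept (phi4HmcEnergy J lam) (hmcProposal J lam δ N) (φ, p) * momentumWeight p)
          / momentumZ n := by
  have hZp := momentumZ_pos n
  unfold hmcOpOf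
  refine div_le_div_of_nonneg_right ?_ hZp.le
  refine integral_mono_of_nonneg (Eventually.of_forall fun p => ?_)
    (integrable_involAccept_mul_momentumWeight J lam δ N φ) (Eventually.of_forall fun p => ?_)
  · have ha0 := involAccept_nonneg (phi4HmcEnergy J lam) (hmcProposal J lam δ N) (φ, p)
    have ha1 := involAccept_le_one (phi4HmcEnergy J lam) (hmcProposal J lam δ N) (φ, p)
    have hw0 : 0 ≤ momentumWeight p := (Real.exp_pos _).le
    show (0 : ℝ) ≤ (involAccept (phi4HmcEnergy J lam) (hmcProposal J lam δ N) (φ, p)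
        * (1 - χ (hmcProposal J lam δ N (φ, p)).1)
        + (1 - involAccept (phi4HmcEnergy J lam) (hmcProposal J lam δ N) (φ, p)) * (1 - χ φ))
        * momentumWeight p
    rw [hφ]
    rcases h01 (hmcProposal J lam δ N (φ, p)).1 with h | h <;>
      · rw [h]; nlinarith
  · have ha0 := involAccept_nonneg (phi4HmcEnergy J lam) (hmcProposal J lam δ N) (φ, p)
    have hw0 : 0 ≤ momentumWeight p := (Real.exp_pos _).le
    show (involAccept (phi4HmcEnergy J lam) (hmcProposal J lam δ N) (φ, p)
        * (1 - χ (hmcProposal J lam δ N (φ, p)).1)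
        + (1 - involAccept (phi4HmcEnergy J lam) (hmcProposal J lam δ N) (φ, p)) * (1 - χ φ))
        * momentumWeight p
      ≤ involAccept (phi4HmcEnergy J lam) (hmcProposal J lam δ N) (φ, p) * momentumWeight p
    rw [hφ, sub_self, mul_zero, add_zero]
    refine mul_le_mul_of_nonneg_right ?_ hw0
    rcases h01 (hmcProposal J lam δ N (φ, p)).1 with h | h
    · rw [h, sub_zero, mul_one]
    · rw [h, sub_self, mul_zero]; exact ha0

/-- **THE DIRICHLET FORM OF A RARELY-LEFT INDICATOR.**  `λ > 0`, real `J`, `Ψ = hmcProposal J λ δ N`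
(any `δ`, `N`); `χ` bounded measurable with values in `{0, 1}` such that from every configuration
with `χ = 1` the update is accepted with probability at most `ε`; `g = χ − c` for any constant `c`.
Then `∫ g² e^{−S} − ∫ g (K g) e^{−S} ≤ ε ∫ χ e^{−S}`. -/
theorem hmc_dirichlet_indicator_le {lam : ℝ} (hlam : 0 < lam) (J : Fin (n + 1) → Fin (n + 1) → ℝ)
    (δ : ℝ) (N : ℕ) {χ : (Fin (n + 1) → ℝ) → ℝ} (hχ : BddObs χ) (h01 : ∀ φ, χ φ = 0 ∨ χ φ = 1)
    {ε : ℝ} (hacc : ∀ φ, χ φ = 1 →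
      (∫ p, involAccept (phi4HmcEnergy J lam) (hmcProposal J lam δ N) (φ, p) * momentumWeight p)
          / momentumZ n ≤ ε) (c : ℝ) :
    (∫ φ, (χ φ - c) ^ 2 * gibbsWeight J lam φ)
        - ∫ φ, (χ φ - c) * hmcOpPhi4 J lam δ N (fun ψ => χ ψ - c) φ * gibbsWeight J lam φ
      ≤ ε * ∫ φ, χ φ * gibbsWeight J lam φ := by
  have hco := latticePhi4Action_coercive hlam J
  have hΨm := measurable_hmcProposal J lam δ N (Λ := Fin (n + 1))
  have hΨi := hmcProposal_involutive J lam δ N (Λ := Fin (n + 1))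
  have hΨμ : MeasurePreserving (hmcProposal J lam δ N)
      ((volume : Measure (Fin (n + 1) → ℝ)).prod volume)
      ((volume : Measure (Fin (n + 1) → ℝ)).prod volume) := measurePreserving_hmcProposal J lam δ N
  set K := hmcOpOf J lam (hmcProposal J lam δ N) with hK
  have hKdef : hmcOpPhi4 J lam δ N = K := rfl
  rw [hKdef]
  have h1 : BddObs (fun _ : Fin (n + 1) → ℝ => (1 : ℝ)) := bddObs_const 1
  have hKχ : BddObs (K χ) := bddObs_hmcOpOf J lam hΨm hχ
  -- `K(χ − c) = Kχ − c` and `K(1 − χ) = 1 − Kχ`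
  have hKg : ∀ φ, K (fun ψ => χ ψ - c) φ = K χ φ - c := by
    intro φ
    have h := hmcOpOf_add_mul_bddObs J lam hΨm hχ h1 (-c) φ
    have e : (fun s : Fin (n + 1) → ℝ => χ s + -c * (1 : ℝ)) = fun ψ => χ ψ - c := by
      funext s; ring
    rw [e] at h
    rw [hK, h, hmcOpOf_one]
    ring
  have hK1χ : ∀ φ, K (fun ψ => 1 - χ ψ) φ = 1 - K χ φ := by
    intro φ
    have h := hmcOpOf_add_mul_bddObs J lam hΨm h1 hχ (-1) φ
    have e : (fun s : Fin (n + 1) → ℝ => (1 : ℝ) + -1 * χ s) = fun ψ => 1 - χ ψ := by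
      funext s; ring
    rw [e] at h
    rw [hK, h, hmcOpOf_one]
    ring
  -- `∫ (Kχ) w = ∫ χ w` (reversibility against the constant `1`)
  have hKint : ∫ φ, K χ φ * gibbsWeight J lam φ = ∫ φ, χ φ * gibbsWeight J lam φ := by
    have h := hmcOpOf_reversible_bddObs one_pos hco hΨm hΨi hΨμ hχ h1
    simp only [mul_one, hmcOpOf_one] at h
    rw [hK]
    exact h
  -- integrability bookkeeping
  have iχ : Integrable (fun φ => χ φ * gibbsWeight J lam φ) := by
    have h := bddObs_integrable_mul_mul_gibbsWeight one_pos hco hχ h1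
    exact h.congr (Eventually.of_forall fun φ => by simp only [mul_one])
  have iKχ : Integrable (fun φ => K χ φ * gibbsWeight J lam φ) := by
    have h := bddObs_integrable_mul_mul_gibbsWeight one_pos hco hKχ h1
    exact h.congr (Eventually.of_forall fun φ => by simp only [mul_one])
  have iχKχ : Integrable (fun φ => χ φ * K χ φ * gibbsWeight J lam φ) :=
    bddObs_integrable_mul_mul_gibbsWeight one_pos hco hχ hKχ
  -- the Dirichlet form equals `∫ χ (1 − Kχ) w`
  have hχsq : ∀ φ, χ φ ^ 2 = χ φ := fun φ => by
    rcases h01 φ with h | h <;> rw [h] <;> norm_num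
  have hg : BddObs (fun ψ : Fin (n + 1) → ℝ => χ ψ - c) := by
    have h := bddObs_add_mul hχ h1 (-c)
    have e : (fun φ : Fin (n + 1) → ℝ => χ φ + -c * (1 : ℝ)) = fun ψ => χ ψ - c := by
      funext s; ring
    rw [e] at h
    exact h
  have iA : Integrable (fun φ => (χ φ - c) ^ 2 * gibbsWeight J lam φ) := by
    have h := bddObs_integrable_mul_mul_gibbsWeight one_pos hco hg hg
    exact h.congr (Eventually.of_forall fun φ => by simp only [sq])
  have iB : Integrable (fun φ => (χ φ - c) * K (fun ψ => χ ψ - c) φ * gibbsWeight J lam φ) :=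
    bddObs_integrable_mul_mul_gibbsWeight one_pos hco hg (bddObs_hmcOpOf J lam hΨm hg)
  have iX : Integrable (fun φ => χ φ * gibbsWeight J lam φ - χ φ * K χ φ * gibbsWeight J lam φ) :=
    iχ.sub' iχKχ
  have iY : Integrable (fun φ => c * (χ φ * gibbsWeight J lam φ - K χ φ * gibbsWeight J lam φ)) :=
    (iχ.sub' iKχ).const_mul c
  have hY : ∫ φ, c * (χ φ * gibbsWeight J lam φ - K χ φ * gibbsWeight J lam φ) = 0 := by
    rw [integral_const_mul, integral_sub iχ iKχ, hKint, sub_self, mul_zero]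
  have hform : (∫ φ, (χ φ - c) ^ 2 * gibbsWeight J lam φ)
        - ∫ φ, (χ φ - c) * K (fun ψ => χ ψ - c) φ * gibbsWeight J lam φ
      = ∫ φ, (χ φ * gibbsWeight J lam φ - χ φ * K χ φ * gibbsWeight J lam φ) := by
    rw [← integral_sub iA iB]
    have e : ∀ φ, (χ φ - c) ^ 2 * gibbsWeight J lam φ
          - (χ φ - c) * K (fun ψ => χ ψ - c) φ * gibbsWeight J lam φ
        = (χ φ * gibbsWeight J lam φ - χ φ * K χ φ * gibbsWeight J lam φ)
          - c * (χ φ * gibbsWeight J lam φ - K χ φ * gibbsWeight J lam φ) := by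
      intro φ
      rw [hKg φ, show (χ φ - c) ^ 2 = χ φ ^ 2 - 2 * c * χ φ + c ^ 2 by ring, hχsq φ]
      ring
    simp_rw [e]
    rw [integral_sub iX iY, hY, sub_zero]
  have e3 : ∀ φ, χ φ * K (fun ψ => 1 - χ ψ) φ * gibbsWeight J lam φ
      = χ φ * gibbsWeight J lam φ - χ φ * K χ φ * gibbsWeight J lam φ := by
    intro φ
    rw [hK1χ φ]
    ring
  rw [hform]
  simp_rw [← e3]
  rw [← integral_const_mul]
  -- pointwise: `χ · K(1 − χ) ≤ ε χ`
  have h1χ : BddObs (fun ψ : Fin (n + 1) → ℝ => 1 - χ ψ) := by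
    have h := bddObs_add_mul h1 hχ (-1)
    have e : (fun φ : Fin (n + 1) → ℝ => (1 : ℝ) + -1 * χ φ) = fun ψ => 1 - χ ψ := by
      funext s; ring
    rw [e] at h
    exact h
  have iR : Integrable (fun φ => χ φ * K (fun ψ => 1 - χ ψ) φ * gibbsWeight J lam φ) :=
    bddObs_integrable_mul_mul_gibbsWeight one_pos hco hχ (bddObs_hmcOpOf J lam hΨm h1χ)
  refine integral_mono iR (iχ.const_mul ε) fun φ => ?_
  show χ φ * K (fun ψ => 1 - χ ψ) φ * gibbsWeight J lam φ ≤ ε * (χ φ * gibbsWeight J lam φ)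
  have hwφ := (gibbsWeight_pos J lam φ).le
  rcases h01 φ with h0 | h1'
  · simp only [h0, zero_mul, mul_zero, le_refl]
  · rw [h1', one_mul, one_mul]
    exact mul_le_mul_of_nonneg_right ((hmcOpOf_one_sub_le_accept J lam δ N h01 h1').trans
      (hacc φ h1')) hwφ

/-! ## §2 No spectral gap -/

/-- `⟨(χ − a)²⟩`-bookkeeping for a `0/1`-valued `χ` with `a Z = ∫ χ w`: `∫ (χ − a)² w = (1 − a) ∫ χ w`. -/
theorem integral_indicator_var {lam : ℝ} (hlam : 0 < lam) (J : Fin (n + 1) → Fin (n + 1) → ℝ)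
    {χ : (Fin (n + 1) → ℝ) → ℝ} (hχ : BddObs χ) (h01 : ∀ φ, χ φ = 0 ∨ χ φ = 1) :
    ∫ φ, (χ φ - gibbsExpect J lam χ) ^ 2 * gibbsWeight J lam φ
      = (1 - gibbsExpect J lam χ) * ∫ φ, χ φ * gibbsWeight J lam φ := by
  have hco := latticePhi4Action_coercive hlam J
  have hZ := gibbsZ_pos hlam J
  have hw := integrable_gibbsWeight hlam J
  have iχ : Integrable (fun φ => χ φ * gibbsWeight J lam φ) := by
    have h := bddObs_integrable_mul_mul_gibbsWeight one_pos hco hχ (bddObs_const 1)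
    exact h.congr (Eventually.of_forall fun φ => by simp only [mul_one])
  set a := gibbsExpect J lam χ with ha
  have haZ : a * gibbsZ J lam = ∫ φ, χ φ * gibbsWeight J lam φ := by
    rw [ha]; unfold gibbsExpect; exact div_mul_cancel₀ _ hZ.ne'
  have hχsq : ∀ φ, χ φ ^ 2 = χ φ := fun φ => by
    rcases h01 φ with h | h <;> rw [h] <;> norm_num
  have e : ∀ φ, (χ φ - a) ^ 2 * gibbsWeight J lam φ
      = (1 - 2 * a) * (χ φ * gibbsWeight J lam φ) + a ^ 2 * gibbsWeight J lam φ := by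
    intro φ
    rw [show (χ φ - a) ^ 2 = χ φ ^ 2 - 2 * a * χ φ + a ^ 2 by ring, hχsq φ]
    ring
  simp_rw [e]
  rw [integral_add (iχ.const_mul _) (hw.const_mul _), integral_const_mul, integral_const_mul]
  unfold gibbsZ at haZ
  have h2 : a ^ 2 * (∫ φ, gibbsWeight J lam φ) = a * ∫ φ, χ φ * gibbsWeight J lam φ := by
    rw [sq, mul_assoc, haZ]
  linarith

/-- **ONE-STEP HMC FOR LATTICE φ⁴ HAS NO SPECTRAL GAP.**  Every `λ > 0`, every real `J`, every step
size `δ > 0`; `K = hmcOpPhi4 J λ δ 1` (refresh, one qpq leapfrog step, flip, Metropolis test).  For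
every `ε > 0` there is `t ≥ 1` such that the centred indicator `g = χ_t − ⟨χ_t⟩` of the box
`A_t = {t ≤ φ_x ≤ 2t ∀x}` is a non-trivial bounded observable (`∫ g² e^{−S} > 0`) with lag-one
autocorrelation `ρ_g(1) = ∫ g (K g) e^{−S} / ∫ g² e^{−S} ≥ 1 − ε`. -/
theorem hmcPhi4_oneStep_no_spectral_gap {lam δ : ℝ} (hlam : 0 < lam) (hδ : 0 < δ)
    (J : Fin (n + 1) → Fin (n + 1) → ℝ) {ε : ℝ} (hε : 0 < ε) :
    ∃ t : ℝ, 1 ≤ t ∧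
      0 < ∫ φ, ((if (∀ x, t ≤ φ x ∧ φ x ≤ 2 * t) then (1 : ℝ) else 0)
          - gibbsExpect J lam (fun ψ => if (∀ x, t ≤ ψ x ∧ ψ x ≤ 2 * t) then (1 : ℝ) else 0)) ^ 2
          * gibbsWeight J lam φ ∧
      1 - ε ≤ (∫ φ, ((if (∀ x, t ≤ φ x ∧ φ x ≤ 2 * t) then (1 : ℝ) else 0)
          - gibbsExpect J lam (fun ψ => if (∀ x, t ≤ ψ x ∧ ψ x ≤ 2 * t) then (1 : ℝ) else 0))
        * hmcOpPhi4 J lam δ 1 (fun ψ => (if (∀ x, t ≤ ψ x ∧ ψ x ≤ 2 * t) then (1 : ℝ) else 0)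
          - gibbsExpect J lam (fun ψ => if (∀ x, t ≤ ψ x ∧ ψ x ≤ 2 * t) then (1 : ℝ) else 0)) φ
        * gibbsWeight J lam φ)
        / ∫ φ, ((if (∀ x, t ≤ φ x ∧ φ x ≤ 2 * t) then (1 : ℝ) else 0)
          - gibbsExpect J lam (fun ψ => if (∀ x, t ≤ ψ x ∧ ψ x ≤ 2 * t) then (1 : ℝ) else 0)) ^ 2
          * gibbsWeight J lam φ := by
  have hco := latticePhi4Action_coercive hlam J
  have hZ := gibbsZ_pos hlam J
  -- second moment of `φ₀`, for Chebyshev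
  set M₂ := ∫ φ : Fin (n + 1) → ℝ, φ 0 ^ 2 * gibbsWeight J lam φ with hM₂
  have hM₂0 : 0 ≤ M₂ := integral_nonneg fun φ => mul_nonneg (sq_nonneg _) (gibbsWeight_pos J lam φ).le
  -- the tail-rejection scale, beyond `T₀ = 1 + 2 M₂/Z`
  obtain ⟨t, htT, ht1, hacc⟩ := hmcPhi4_oneStep_accept_le_of_mem_box hlam hδ J (half_pos hε)
    (1 + 2 * M₂ / gibbsZ J lam)
  have ht0 : 0 < t := by linarith
  refine ⟨t, ht1, ?_⟩
  set χ : (Fin (n + 1) → ℝ) → ℝ := fun φ => if (∀ x, t ≤ φ x ∧ φ x ≤ 2 * t) then (1 : ℝ) else 0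
    with hχdef
  have hχ : BddObs χ := boxInd_bddObs t
  have h01 : ∀ φ, χ φ = 0 ∨ χ φ = 1 := fun φ => by
    rw [hχdef]; dsimp only; split_ifs
    · exact Or.inr rfl
    · exact Or.inl rfl
  set a := gibbsExpect J lam χ with ha
  set I := ∫ φ, χ φ * gibbsWeight J lam φ with hI
  have hIpos : 0 < I := integral_boxInd_pos hlam J ht0
  have hIle : I ≤ 1 / t ^ 2 * M₂ := integral_boxInd_le hlam J ht0
  have haI : a * gibbsZ J lam = I := by
    rw [ha, hI]; unfold gibbsExpect; exact div_mul_cancel₀ _ hZ.ne'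
  have ha0 : 0 < a := by
    rw [ha]; unfold gibbsExpect; exact div_pos hIpos hZ
  -- `a ≤ ½` by Chebyshev and the choice of `T₀`
  have hahalf : a ≤ 1 / 2 := by
    have ht2 : 2 * M₂ / gibbsZ J lam ≤ t ^ 2 := by nlinarith
    have h1 : 2 * M₂ ≤ t ^ 2 * gibbsZ J lam := by
      rw [div_le_iff₀ hZ] at ht2; linarith
    have h2 : I * t ^ 2 ≤ M₂ := by
      have := hIle
      rw [one_div, ← div_eq_inv_mul, le_div_iff₀ (by positivity)] at this
      linarith
    have h3 : a * gibbsZ J lam * t ^ 2 ≤ M₂ := by rw [haI]; exact h2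
    have ht2pos : 0 < t ^ 2 := by positivity
    nlinarith [mul_pos hZ ht2pos]
  -- variance and Dirichlet form
  have hP : ∫ φ, (χ φ - a) ^ 2 * gibbsWeight J lam φ = (1 - a) * I :=
    integral_indicator_var hlam J hχ h01
  have hPpos : 0 < (1 - a) * I := mul_pos (by linarith) hIpos
  have hacc' : ∀ φ, χ φ = 1 →
      (∫ p, involAccept (phi4HmcEnergy J lam) (hmcProposal J lam δ 1) (φ, p) * momentumWeight p)
          / momentumZ n ≤ ε / 2 := by
    intro φ hφ
    refine hacc φ ?_
    by_contra hnot
    have : χ φ = 0 := by rw [hχdef]; dsimp only; rw [if_neg hnot]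
    rw [this] at hφ
    exact zero_ne_one hφ
  have hdir := hmc_dirichlet_indicator_le hlam J δ 1 hχ h01 hacc' a
  refine ⟨by rw [hP]; exact hPpos, ?_⟩
  rw [hP] at hdir ⊢
  -- `ρ = C₁/P ≥ 1 − (ε/2) I/P = 1 − ε/(2(1 − a)) ≥ 1 − ε`
  rw [le_div_iff₀ hPpos]
  have h1a : 1 / 2 ≤ 1 - a := by linarith
  nlinarith [mul_nonneg hε.le hIpos.le]

/-- **Hence the integrated autocorrelation time is unbounded over bounded observables**: for every
`ε > 0`, with `t` and `g = χ_t − ⟨χ_t⟩` as above, if the autocorrelation series of `g` is summable and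
`ρ_g(1) < 1` then `τ_int(g) ≥ 1/ε − ½` per update (Madras–Sokal floor of `ReversibleOperatorL2`). -/
theorem hmcPhi4_oneStep_tauInt_unbounded {lam δ : ℝ} (hlam : 0 < lam) (hδ : 0 < δ)
    (J : Fin (n + 1) → Fin (n + 1) → ℝ) {ε : ℝ} (hε : 0 < ε) :
    ∃ t : ℝ, 1 ≤ t ∧
      ((Summable fun k => (∫ φ, ((if (∀ x, t ≤ φ x ∧ φ x ≤ 2 * t) then (1 : ℝ) else 0)
          - gibbsExpect J lam (fun ψ => if (∀ x, t ≤ ψ x ∧ ψ x ≤ 2 * t) then (1 : ℝ) else 0))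
        * ((hmcOpPhi4 J lam δ 1)^[k + 1] (fun ψ => (if (∀ x, t ≤ ψ x ∧ ψ x ≤ 2 * t) then (1 : ℝ) else 0)
          - gibbsExpect J lam (fun ψ => if (∀ x, t ≤ ψ x ∧ ψ x ≤ 2 * t) then (1 : ℝ) else 0))) φ
        * gibbsWeight J lam φ)
        / ∫ φ, ((if (∀ x, t ≤ φ x ∧ φ x ≤ 2 * t) then (1 : ℝ) else 0)
          - gibbsExpect J lam (fun ψ => if (∀ x, t ≤ ψ x ∧ ψ x ≤ 2 * t) then (1 : ℝ) else 0)) ^ 2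
          * gibbsWeight J lam φ) →
      (∫ φ, ((if (∀ x, t ≤ φ x ∧ φ x ≤ 2 * t) then (1 : ℝ) else 0)
          - gibbsExpect J lam (fun ψ => if (∀ x, t ≤ ψ x ∧ ψ x ≤ 2 * t) then (1 : ℝ) else 0))
        * hmcOpPhi4 J lam δ 1 (fun ψ => (if (∀ x, t ≤ ψ x ∧ ψ x ≤ 2 * t) then (1 : ℝ) else 0)
          - gibbsExpect J lam (fun ψ => if (∀ x, t ≤ ψ x ∧ ψ x ≤ 2 * t) then (1 : ℝ) else 0)) φ
        * gibbsWeight J lam φ)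
        / (∫ φ, ((if (∀ x, t ≤ φ x ∧ φ x ≤ 2 * t) then (1 : ℝ) else 0)
          - gibbsExpect J lam (fun ψ => if (∀ x, t ≤ ψ x ∧ ψ x ≤ 2 * t) then (1 : ℝ) else 0)) ^ 2
          * gibbsWeight J lam φ) < 1 →
      1 / ε - 1 / 2 ≤ tauInt (fun k => (∫ φ, ((if (∀ x, t ≤ φ x ∧ φ x ≤ 2 * t) then (1 : ℝ) else 0)
          - gibbsExpect J lam (fun ψ => if (∀ x, t ≤ ψ x ∧ ψ x ≤ 2 * t) then (1 : ℝ) else 0))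
        * ((hmcOpPhi4 J lam δ 1)^[k] (fun ψ => (if (∀ x, t ≤ ψ x ∧ ψ x ≤ 2 * t) then (1 : ℝ) else 0)
          - gibbsExpect J lam (fun ψ => if (∀ x, t ≤ ψ x ∧ ψ x ≤ 2 * t) then (1 : ℝ) else 0))) φ
        * gibbsWeight J lam φ)
        / ∫ φ, ((if (∀ x, t ≤ φ x ∧ φ x ≤ 2 * t) then (1 : ℝ) else 0)
          - gibbsExpect J lam (fun ψ => if (∀ x, t ≤ ψ x ∧ ψ x ≤ 2 * t) then (1 : ℝ) else 0)) ^ 2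
          * gibbsWeight J lam φ)) := by
  have hco := latticePhi4Action_coercive hlam J
  obtain ⟨t, ht1, hP, hρ⟩ := hmcPhi4_oneStep_no_spectral_gap hlam hδ J hε
  refine ⟨t, ht1, fun hs hlt => ?_⟩
  have hΨm := measurable_hmcProposal J lam δ 1 (Λ := Fin (n + 1))
  have hΨi := hmcProposal_involutive J lam δ 1 (Λ := Fin (n + 1))
  have hΨμ : MeasurePreserving (hmcProposal J lam δ 1)
      ((volume : Measure (Fin (n + 1) → ℝ)).prod volume)
      ((volume : Measure (Fin (n + 1) → ℝ)).prod volume) := measurePreserving_hmcProposal J lam δ 1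
  obtain ⟨hθm, B, hθb⟩ := boxInd_bddObs (n := n) t
  obtain ⟨hgm, hgb, -⟩ := centred_observable hlam J hθm hθb
  have hg : BddObs (fun ψ : Fin (n + 1) → ℝ => (if (∀ x, t ≤ ψ x ∧ ψ x ≤ 2 * t) then (1 : ℝ) else 0)
      - gibbsExpect J lam (fun ψ => if (∀ x, t ≤ ψ x ∧ ψ x ≤ 2 * t) then (1 : ℝ) else 0)) :=
    ⟨hgm, _, hgb⟩
  have hfloor := RevOp.tauInt_ge (μ := volume) (A := BddObs)
    (K := hmcOpOf J lam (hmcProposal J lam δ 1)) (w := gibbsWeight J lam)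
    (fun φ => (gibbsWeight_pos J lam φ).le)
    (fun f h hf hh => bddObs_integrable_mul_mul_gibbsWeight one_pos hco hf hh)
    (fun f h c hf hh => bddObs_add_mul hf hh c)
    (fun f hf => bddObs_hmcOpOf J lam hΨm hf)
    (fun f h c hf hh x => hmcOpOf_add_mul_bddObs J lam hΨm hf hh c x)
    (fun f h hf hh => hmcOpOf_reversible_bddObs one_pos hco hΨm hΨi hΨμ hf hh)
    (fun f hf => hmcOpOf_contraction_bddObs one_pos hco hΨm hΨi hΨμ hf) hg hs hlt
  refine le_trans ?_ hfloor
  -- `(1 + ρ)/(2(1 − ρ)) ≥ (2 − ε)/(2ε) = 1/ε − ½` for `1 − ε ≤ ρ < 1`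
  set r := (∫ φ, ((if (∀ x, t ≤ φ x ∧ φ x ≤ 2 * t) then (1 : ℝ) else 0)
          - gibbsExpect J lam (fun ψ => if (∀ x, t ≤ ψ x ∧ ψ x ≤ 2 * t) then (1 : ℝ) else 0))
        * hmcOpOf J lam (hmcProposal J lam δ 1)
          (fun ψ => (if (∀ x, t ≤ ψ x ∧ ψ x ≤ 2 * t) then (1 : ℝ) else 0)
          - gibbsExpect J lam (fun ψ => if (∀ x, t ≤ ψ x ∧ ψ x ≤ 2 * t) then (1 : ℝ) else 0)) φ
        * gibbsWeight J lam φ)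
        / ∫ φ, ((if (∀ x, t ≤ φ x ∧ φ x ≤ 2 * t) then (1 : ℝ) else 0)
          - gibbsExpect J lam (fun ψ => if (∀ x, t ≤ ψ x ∧ ψ x ≤ 2 * t) then (1 : ℝ) else 0)) ^ 2
          * gibbsWeight J lam φ with hr
  have hρ' : 1 - ε ≤ r := hρ
  have hlt' : r < 1 := hlt
  rw [div_sub_div _ _ hε.ne' two_ne_zero, div_le_div_iff₀ (by positivity) (by linarith)]
  nlinarith

end NoGap

end Summit.Ventures.LatticeQCDFlow.Exactness
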